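import Literature.Analysis.FluidPDE.ForcedHeatDuhamelHolder
import Literature.Analysis.UnboundedOperators.HeatDuhamelSliceRegularity
import HarnessLib

/-!
# Time regularity of the caloric extension and of the forward Duhamel integrals

Analysis/FluidPDE support file (everything proved, no definitions, no named facts) on the proof
path of the named fact `Literature.Analysis.FluidPDE.jia_sverak_2014_local_higher_regularity`
(`JiaSverak2014LocalRegularity.lean`; H. Jia, V. Šverák, Invent. Math. 196 (2014) =
arXiv:1204.0529, §4 proof of Thm. 4.1: the spatial derivatives of the localised solution are
bounded *and Lipschitz in time* up to the initial time; in the mild form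
`W = e^{tΔ}W₀ + ∫₀ᵗ e^{(t−s)Δ}G₀ − Σⱼ ∫₀ᵗ ∂ⱼe^{(t−s)Δ}G₁ʲ` of the cut-off equation this is the
time regularity of the three terms). Companion of `ForcedHeatDuhamelHolder.lean` (spatial Hölder
gain); here:

* `norm_fderiv_fderiv_iteratedFDeriv` — `‖D²(Dⁿh)‖ = ‖Dⁿ⁺²h‖`;
* `norm_iteratedFDeriv_heatExtension_sub_self_le`,
  `norm_iteratedFDeriv_heatExtension_sub_heatExtension_le` — **`Dⁿe^{tΔ}h` is Lipschitz in
  time** for `h ∈ Cⁿ⁺²` bounded: `‖Dⁿe^{tΔ}h(x) − Dⁿe^{sΔ}h(x)‖ ≤ d A (t − s)`, `0 ≤ s ≤ t`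
  (`∂ₜe^{tΔ} = e^{tΔ}Δ`, the tree's `HeatHolder.norm_heatExtension_sub_self_le_of_C2`, and the
  semigroup law);
* `iteratedFDeriv_heatDuhamel_eq_setIntegral` — derivatives of the Duhamel integral of bounded
  `Cᵐ` data pass under the time integral;
* `norm_iteratedFDeriv_heatDuhamel_sub_le` — **`Dⁿ∫₀ᵗe^{(t−τ)Δ}g(τ)dτ` is Lipschitz in time**
  with constant `(1 + d) A` for data with `g(τ) ∈ Cⁿ⁺²` bounded by `A` on `(0, T)`, `T ≤ 1`;
* `norm_iteratedFDeriv_heatGradDuhamel_sub_le` — the same for `Dⁿ∫₀ᵗ∂ᵥe^{(t−τ)Δ}g(τ)dτ` with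
  `g(τ) ∈ Cⁿ⁺³`, `‖v‖ ≤ 1`;
* `norm_heatDuhamel_sub_le_of_holder`, `norm_heatGradDuhamel_sub_le_of_holder` — **Hölder
  continuity in time** of the two Duhamel integrals of `C^{0,1/2}` data (moduli `A(t−s) +
  cA(t−s)^{1/4}` and `cA((t−s)^{3/4} + (t−s)^{1/2})`), which gives the continuity in time used to
  upgrade an a.e. mild representation to an everywhere one.

## Mathlib / tree search

Tree (used): `UnboundedOperators.iteratedFDeriv_heatExtension_of_bounded`,
`norm_iteratedFDeriv_heatExtension_le_of_bounded`, `fderiv_heatExtension_of_bounded`,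
`contDiff_heatExtension_of_bound`, `heatExtension_clm_comp_of_bound`, `heatExtension_add_holds`,
`norm_heatExtension_le_of_bound`, `norm_heatExtension_sub_self_le_of_holder`
(`UnboundedOperators/*`), `HeatHolder.norm_heatExtension_sub_self_le_of_C2`
(`HeatDuhamelSliceRegularity`), `heatDuhamel`, `heatGradDuhamel`, `heatDuhamelIntegrand`,
`contDiff_heatDuhamelIntegrand`, `stronglyMeasurable_uncurry_heatDuhamelIntegrand`,
`exists_holder_gain_heatExtension`, `norm_heatExtension_sub_heatExtension_le_of_holder`
(`ForcedHeatDuhamelHolder`), `FunctionSpaces.contDiff_integral_of_dominated_iteratedFDeriv`.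

## References

* H. Jia, V. Šverák, Invent. Math. 196 (2014) = arXiv:1204.0529, §3 proof of Thm. 3.2 (p. 9), §4
  proof of Thm. 4.1. Bib key `JiaSverak2014`.
* L. C. Evans, *Partial Differential Equations* (2010), §2.3.1 (Duhamel's principle, the heat
  semigroup). Bib key `Evans2010`.
-/

noncomputable section

open MeasureTheory Set Function Filter Metric Real
open _root_.Topology
open scoped ENNReal NNReal ContDiff

namespace Literature.Analysis.FluidPDE

open UnboundedOperators (heatKernel heatExtension)
open FunctionSpaces (contDiff_integral_of_dominated_iteratedFDeriv norm_iteratedFDeriv_integral_le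
  stronglyMeasurable_iteratedFDeriv_param stronglyMeasurable_fderiv_apply_param)

-- nested operator types `E →L[ℝ] E →L[ℝ] E [×n]→L[ℝ] F`
set_option maxSynthPendingDepth 3

variable {E : Type*} [NormedAddCommGroup E] [InnerProductSpace ℝ E] [FiniteDimensional ℝ E]
  [MeasurableSpace E] [BorelSpace E]
variable {F : Type*} [NormedAddCommGroup F] [NormedSpace ℝ F] [CompleteSpace F]

/-! ### `‖D²(Dⁿh)‖ = ‖Dⁿ⁺²h‖` -/

section IterNorm

omit [InnerProductSpace ℝ E] [FiniteDimensional ℝ E] [MeasurableSpace E] [BorelSpace E] [CompleteSpace F]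
variable [NormedSpace ℝ E]

/-- `D(Dⁿh) = curry ∘ Dⁿ⁺¹h`. This is Mathlib's `fderiv_iteratedFDeriv` (definitional); the name is
kept as a deprecated alias (dedup-01044). [folklore] -/
@[deprecated fderiv_iteratedFDeriv (since := "2026-08-16")]
theorem fderiv_iteratedFDeriv_eq_comp (n : ℕ) (h : E → F) :
    fderiv ℝ (iteratedFDeriv ℝ n h) =
      (continuousMultilinearCurryLeftEquiv ℝ (fun _ : Fin (n + 1) => E) F) ∘ iteratedFDeriv ℝ (n + 1) h :=
  fderiv_iteratedFDeriv

/-- **`‖D²(Dⁿh)(z)‖ = ‖Dⁿ⁺²h(z)‖`** (currying isometries). [folklore] -/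
theorem norm_fderiv_fderiv_iteratedFDeriv (n : ℕ) (h : E → F) (z : E) :
    ‖fderiv ℝ (fderiv ℝ (iteratedFDeriv ℝ n h)) z‖ = ‖iteratedFDeriv ℝ (n + 2) h z‖ := by
  set L := continuousMultilinearCurryLeftEquiv ℝ (fun _ : Fin (n + 1) => E) F with hL
  rw [fderiv_iteratedFDeriv (n := n) (f := h)]
  have e : fderiv ℝ (L ∘ iteratedFDeriv ℝ (n + 1) h) z =
      (L : (E [×(n + 1)]→L[ℝ] F) →L[ℝ] (E →L[ℝ] E [×n]→L[ℝ] F)).comp (fderiv ℝ (iteratedFDeriv ℝ (n + 1) h) z) :=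
    L.toContinuousLinearEquiv.comp_fderiv
  rw [e]
  change ‖L.toLinearIsometry.toContinuousLinearMap.comp (fderiv ℝ (iteratedFDeriv ℝ (n + 1) h) z)‖ = _
  rw [LinearIsometry.norm_toContinuousLinearMap_comp, norm_fderiv_iteratedFDeriv]

end IterNorm

/-! ### Time increments of the caloric extension of `Cⁿ⁺²` data -/

section HeatTime

variable {n : ℕ} {A : ℝ} {h : E → F}

/-- **`‖Dⁿe^{tΔ}h(x) − Dⁿh(x)‖ ≤ d A t`** for `h ∈ Cⁿ⁺²` with all derivatives of order `≤ n + 2`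
bounded by `A` (`d = dim E`): `Dⁿe^{tΔ}h = e^{tΔ}(Dⁿh)` and the heat flow moves bounded `C²` data at
most linearly in time (`∂ₜe^{tΔ}k = e^{tΔ}Δk`, `|Δk| ≤ d‖D²k‖`). [cite: Evans2010, §2.3.1 Theorem 1 (ii)] -/
theorem norm_iteratedFDeriv_heatExtension_sub_self_le (hh : IsCkBounded (n + 2) A h) {t : ℝ}
    (ht : 0 < t) (x : E) :
    ‖iteratedFDeriv ℝ n (heatExtension h t) x - iteratedFDeriv ℝ n h x‖ ≤
      (Module.finrank ℝ E : ℝ) * A * t := by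
  have hc : ContDiff ℝ (n + 2 : ℕ) h := hh.contDiff
  have hcomm := UnboundedOperators.iteratedFDeriv_heatExtension_of_bounded hc (C := fun _ => A)
    (fun j hj z => hh.norm_le j hj z) ht n (by omega)
  rw [hcomm]
  -- `K = Dⁿh` is `C²` with `K`, `DK`, `D²K` bounded by `A`
  set K : E → E [×n]→L[ℝ] F := iteratedFDeriv ℝ n h with hK
  have hK2 : ContDiff ℝ 2 K := by
    have : (2 : WithTop ℕ∞) + n ≤ (n + 2 : ℕ) := by push_cast; rw [add_comm]
    exact hc.iteratedFDeriv_right (i := n) (m := 2) this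
  have h0 : ∀ z, ‖K z‖ ≤ A := fun z => hh.norm_le n (by omega) z
  have h1 : ∀ z, ‖fderiv ℝ K z‖ ≤ A := fun z => by
    rw [hK, norm_fderiv_iteratedFDeriv]; exact hh.norm_le (n + 1) (by omega) z
  have h2 : ∀ z, ‖iteratedFDeriv ℝ 2 K z‖ ≤ A := fun z => by
    rw [← UnboundedOperators.HeatHolder.norm_fderiv_fderiv_eq, hK, norm_fderiv_fderiv_iteratedFDeriv]
    exact hh.norm_le (n + 2) le_rfl z
  exact UnboundedOperators.HeatHolder.norm_heatExtension_sub_self_le_of_C2 hK2 h0 h1 h2 ht x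

/-- The caloric extension of `Cⁿ⁺²`-bounded data is `Cⁿ⁺²`-bounded with the same constant
(maximum principle for the derivatives). [folklore] -/
theorem IsCkBounded.heatExtension {m : ℕ} (hh : IsCkBounded m A h) {s : ℝ} (hs : 0 < s) :
    IsCkBounded m A (heatExtension h s) :=
  ⟨contDiff_infty.1 (UnboundedOperators.contDiff_heatExtension_of_bound hh.contDiff.continuous
      hh.norm_apply_le hs) m,
    fun _ hj x => UnboundedOperators.norm_iteratedFDeriv_heatExtension_le_of_bounded hh.contDiff
      (C := fun _ => A) (fun i hi z => hh.norm_le i hi z) hs hj x⟩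

/-- **`Dⁿe^{tΔ}h` is Lipschitz in time on `[s, ∞)`, `s > 0`**:
`‖Dⁿe^{tΔ}h(x) − Dⁿe^{sΔ}h(x)‖ ≤ d A (t − s)` for `0 < s ≤ t` (semigroup law
`e^{tΔ} = e^{(t−s)Δ}e^{sΔ}` and the previous estimate for the `Cⁿ⁺²`-bounded slice `e^{sΔ}h`). [cite: Evans2010, §2.3.1] -/
theorem norm_iteratedFDeriv_heatExtension_sub_heatExtension_le (hh : IsCkBounded (n + 2) A h)
    {s t : ℝ} (hs : 0 < s) (hst : s ≤ t) (x : E) :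
    ‖iteratedFDeriv ℝ n (heatExtension h t) x - iteratedFDeriv ℝ n (heatExtension h s) x‖ ≤
      (Module.finrank ℝ E : ℝ) * A * (t - s) := by
  rcases hst.lt_or_eq with hlt | rfl
  · have hmem : MemLp h ∞ (volume : Measure E) :=
      UnboundedOperators.memLp_top_of_continuous_of_bound hh.contDiff.continuous hh.norm_apply_le
    have hsemi : heatExtension h t = heatExtension (heatExtension h s) (t - s) := by
      rw [UnboundedOperators.heatExtension_add_holds hmem le_top hs (sub_pos.2 hlt)]
      congr 1; ring
    rw [hsemi]
    exact norm_iteratedFDeriv_heatExtension_sub_self_le (hh.heatExtension hs) (sub_pos.2 hlt) x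
  · simp only [sub_self, norm_zero, mul_zero, le_refl]

end HeatTime

/-! ### Derivatives of the Duhamel integrals of bounded `Cᵐ` data pass under the time integral -/

section DuhamelDeriv

variable {g : ℝ → E → F} {s t A : ℝ} {m : ℕ}

/-- **`Dʲ∫ₛᵗe^{(t−τ)Δ}g(τ)dτ = ∫ₛᵗ Dʲ(e^{(t−τ)Δ}g(τ))dτ`** (`j ≤ m`) for jointly strongly measurable
data with `g(τ) ∈ Cᵐ` bounded by `A` for `τ ∈ (s, t)`: the derivatives of the Duhamel integrand
are bounded by `A` (maximum principle), so differentiation under the time integral applies. [folklore] -/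
theorem iteratedFDeriv_heatDuhamel_eq_setIntegral (hg : StronglyMeasurable (uncurry g))
    (hreg : ∀ τ ∈ Ioo s t, IsCkBounded m A (g τ)) (hA : 0 ≤ A) {j : ℕ} (hj : j ≤ m) (x : E) :
    iteratedFDeriv ℝ j (heatDuhamel s g t) x =
        ∫ τ in Ioo s t, iteratedFDeriv ℝ j (heatDuhamelIntegrand g s t τ) x ∧
      ∀ τ, ‖iteratedFDeriv ℝ j (heatDuhamelIntegrand g s t τ) x‖ ≤ A := by
  have hcont : ∀ τ ∈ Ioo s t, Continuous (g τ) := fun τ hτ => (hreg τ hτ).contDiff.continuous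
  have hbdd : ∀ τ ∈ Ioo s t, ∀ y, ‖g τ y‖ ≤ A := fun τ hτ y => (hreg τ hτ).norm_apply_le y
  have hmeas := stronglyMeasurable_uncurry_heatDuhamelIntegrand (s := s) (t := t) hg
  have hsmooth := contDiff_heatDuhamelIntegrand (s := s) (t := t) hcont hbdd
  have hb : ∀ i ≤ m, ∀ τ x, ‖iteratedFDeriv ℝ i (heatDuhamelIntegrand g s t τ) x‖ ≤ A := by
    intro i hi τ x
    exact norm_iteratedFDeriv_heatDuhamelIntegrand_le (B := fun _ => A) (fun _ => hA)
      (fun τ hτ x => UnboundedOperators.norm_iteratedFDeriv_heatExtension_le_of_bounded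
        (hreg τ hτ).contDiff (C := fun _ => A) (fun i' hi' z => (hreg τ hτ).norm_le i' hi' z)
        (sub_pos.2 hτ.2) hi x) τ x
  have hbi : ∀ i ≤ m, Integrable (fun _ : ℝ => A) (volume.restrict (Ioo s t)) := fun _ _ =>
    integrableOn_const (measure_Ioo_lt_top.ne)
  have hpack := contDiff_integral_of_dominated_iteratedFDeriv (μ := volume.restrict (Ioo s t))
    (bound := fun _ _ => A) hmeas hsmooth hbi hb
  have hfun : heatDuhamel s g t = fun x => ∫ τ in Ioo s t, heatDuhamelIntegrand g s t τ x :=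
    funext fun x => heatDuhamel_eq_integral_heatDuhamelIntegrand s g t x
  refine ⟨?_, fun τ => hb j hj τ x⟩
  rw [hfun]
  exact hpack.2 j hj x

/-- **The same for the heat-gradient Duhamel integral**:
`Dʲ∫ₛᵗ∂ᵥe^{(t−τ)Δ}g(τ)dτ = ∫ₛᵗ Dʲ(∂ᵥe^{(t−τ)Δ}g(τ))dτ`, `j ≤ m`, for `g(τ) ∈ Cᵐ⁺¹` bounded by `A`;
the integrands are bounded by `‖v‖A`. [folklore] -/
theorem iteratedFDeriv_heatGradDuhamel_eq_setIntegral (hg : StronglyMeasurable (uncurry g))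
    (hreg : ∀ τ ∈ Ioo s t, IsCkBounded (m + 1) A (g τ)) (hA : 0 ≤ A) (v : E) {j : ℕ} (hj : j ≤ m)
    (x : E) :
    iteratedFDeriv ℝ j (heatGradDuhamel s g v t) x =
        ∫ τ in Ioo s t, iteratedFDeriv ℝ j (fun y => fderiv ℝ (heatDuhamelIntegrand g s t τ) y v) x ∧
      ∀ τ, ‖iteratedFDeriv ℝ j (fun y => fderiv ℝ (heatDuhamelIntegrand g s t τ) y v) x‖ ≤ ‖v‖ * A := by
  have hcont : ∀ τ ∈ Ioo s t, Continuous (g τ) := fun τ hτ => (hreg τ hτ).contDiff.continuous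
  have hbdd : ∀ τ ∈ Ioo s t, ∀ y, ‖g τ y‖ ≤ A := fun τ hτ y => (hreg τ hτ).norm_apply_le y
  set Nd := heatDuhamelIntegrand g s t with hNd
  have hmeas := stronglyMeasurable_uncurry_heatDuhamelIntegrand (s := s) (t := t) hg
  have hsmooth := contDiff_heatDuhamelIntegrand (s := s) (t := t) hcont hbdd
  -- the directional-derivative integrand
  set Nd' : ℝ → E → F := fun τ y => fderiv ℝ (Nd τ) y v with hNd'
  have hmeas' : StronglyMeasurable (uncurry Nd') :=
    stronglyMeasurable_fderiv_apply_param hmeas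
      (fun τ y => ((hsmooth τ).differentiable (by simp)) y) v
  have hsmooth' : ∀ τ, ContDiff ℝ ∞ (Nd' τ) := contDiff_fderiv_apply_slice_of_contDiff hsmooth v
  have hb : ∀ i ≤ m, ∀ τ x, ‖iteratedFDeriv ℝ i (Nd' τ) x‖ ≤ ‖v‖ * A := by
    intro i hi τ x
    refine (norm_iteratedFDeriv_fderiv_apply_le (hsmooth τ) v i x).trans ?_
    refine mul_le_mul_of_nonneg_left ?_ (norm_nonneg _)
    exact norm_iteratedFDeriv_heatDuhamelIntegrand_le (B := fun _ => A) (fun _ => hA)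
      (fun τ hτ x => UnboundedOperators.norm_iteratedFDeriv_heatExtension_le_of_bounded
        (hreg τ hτ).contDiff (C := fun _ => A) (fun i' hi' z => (hreg τ hτ).norm_le i' hi' z)
        (sub_pos.2 hτ.2) (Nat.succ_le_succ hi) x) τ x
  have hbi : ∀ i ≤ m, Integrable (fun _ : ℝ => ‖v‖ * A) (volume.restrict (Ioo s t)) := fun _ _ =>
    integrableOn_const (measure_Ioo_lt_top.ne)
  have hpack := contDiff_integral_of_dominated_iteratedFDeriv (μ := volume.restrict (Ioo s t))
    (bound := fun _ _ => ‖v‖ * A) hmeas' hsmooth' hbi hb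
  have hfun : heatGradDuhamel s g v t = fun x => ∫ τ in Ioo s t, Nd' τ x :=
    funext fun x => heatGradDuhamel_eq_integral_fderiv_heatDuhamelIntegrand s g v t x
  refine ⟨?_, fun τ => hb j hj τ x⟩
  rw [hfun]
  exact hpack.2 j hj x

omit [CompleteSpace F] in
/-- Measurability in `τ` of the derivatives of the Duhamel integrand at a fixed point. [folklore] -/
theorem aestronglyMeasurable_iteratedFDeriv_heatDuhamelIntegrand [CompleteSpace F]
    (hg : StronglyMeasurable (uncurry g)) (hcont : ∀ τ ∈ Ioo s t, Continuous (g τ))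
    (hbdd : ∀ τ ∈ Ioo s t, ∀ y, ‖g τ y‖ ≤ A) (j : ℕ) (x : E) (μ : Measure ℝ) :
    AEStronglyMeasurable (fun τ => iteratedFDeriv ℝ j (heatDuhamelIntegrand g s t τ) x) μ :=
  ((stronglyMeasurable_iteratedFDeriv_param (stronglyMeasurable_uncurry_heatDuhamelIntegrand hg)
    (contDiff_heatDuhamelIntegrand hcont hbdd) j).comp_measurable
    (measurable_id.prodMk measurable_const)).aestronglyMeasurable

end DuhamelDeriv

/-! ### Time increments of the Duhamel integrals of `Cⁿ⁺²` data -/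

section DuhamelTime

variable {g : ℝ → E → F} {T A : ℝ} {n : ℕ}

omit [CompleteSpace F] in
/-- `heatDuhamel s g s = 0` (empty time interval). [folklore] -/
theorem heatDuhamel_self (s : ℝ) (g : ℝ → E → F) (x : E) : heatDuhamel s g s x = 0 := by
  simp [heatDuhamel]

omit [CompleteSpace F] in
/-- `heatGradDuhamel s g v s = 0` (empty time interval). [folklore] -/
theorem heatGradDuhamel_self (s : ℝ) (g : ℝ → E → F) (v : E) (x : E) :
    heatGradDuhamel s g v s x = 0 := by
  simp [heatGradDuhamel]

/-- Splitting the time integral: `∫_{(0,t)} = ∫_{(0,s)} + ∫_{(s,t)}` for `0 ≤ s ≤ t` and an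
integrable integrand. [folklore] -/
theorem setIntegral_Ioo_eq_add {G : Type*} [NormedAddCommGroup G] [NormedSpace ℝ G] {f : ℝ → G}
    {s t : ℝ} (hs : 0 ≤ s) (hst : s ≤ t) (hf : IntegrableOn f (Ioo 0 t) volume) :
    ∫ τ in Ioo 0 t, f τ = (∫ τ in Ioo 0 s, f τ) + ∫ τ in Ioo s t, f τ := by
  have h1 : ∫ τ in Ioo 0 t, f τ = ∫ τ in Ioc 0 t, f τ := setIntegral_congr_set Ioo_ae_eq_Ioc
  have h2 : ∫ τ in Ioo 0 s, f τ = ∫ τ in Ioc 0 s, f τ := setIntegral_congr_set Ioo_ae_eq_Ioc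
  have h3 : ∫ τ in Ioo s t, f τ = ∫ τ in Ioc s t, f τ := setIntegral_congr_set Ioo_ae_eq_Ioc
  rw [h1, h2, h3, ← intervalIntegral.integral_of_le (hs.trans hst), ← intervalIntegral.integral_of_le hs,
    ← intervalIntegral.integral_of_le hst]
  have hf' : IntegrableOn f (Ioc 0 t) volume := hf.congr_set_ae Ioo_ae_eq_Ioc.symm
  have hi1 : IntervalIntegrable f volume 0 s :=
    (intervalIntegrable_iff_integrableOn_Ioc_of_le hs).2 (hf'.mono_set (Ioc_subset_Ioc_right hst))
  have hi2 : IntervalIntegrable f volume s t :=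
    (intervalIntegrable_iff_integrableOn_Ioc_of_le hst).2 (hf'.mono_set (Ioc_subset_Ioc_left hs))
  exact (intervalIntegral.integral_add_adjacent_intervals hi1 hi2).symm

/-- **The Duhamel integral of `Cⁿ⁺²` data has `Dⁿ` Lipschitz in time**: if `g` is jointly strongly
measurable with `g(τ) ∈ Cⁿ⁺²` bounded by `A` for `τ ∈ (0, T)`, `T ≤ 1`, then for
`0 ≤ s ≤ t ≤ T`,
`‖Dⁿ(∫₀ᵗe^{(t−τ)Δ}g)(x) − Dⁿ(∫₀ˢe^{(s−τ)Δ}g)(x)‖ ≤ (1 + d) A (t − s)`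
(split `∫₀ᵗ = ∫₀ˢ + ∫ₛᵗ`: the second piece is `≤ (t−s)A`, and on `(0, s)`
`Dⁿe^{(t−τ)Δ}g(τ) − Dⁿe^{(s−τ)Δ}g(τ)` is `≤ dA(t−s)` by the Lipschitz bound for the caloric
extension of the `Cⁿ⁺²` slice `g(τ)`). [cite: JiaSverak2014, §3 proof of Thm. 3.2 (arXiv p. 9), the term u₁] -/
theorem norm_iteratedFDeriv_heatDuhamel_sub_le (hg : StronglyMeasurable (uncurry g))
    (hreg : ∀ τ ∈ Ioo 0 T, IsCkBounded (n + 2) A (g τ)) (hA : 0 ≤ A) (hT1 : T ≤ 1) {s t : ℝ}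
    (hs : 0 ≤ s) (hst : s ≤ t) (htT : t ≤ T) (x : E) :
    ‖iteratedFDeriv ℝ n (heatDuhamel 0 g t) x - iteratedFDeriv ℝ n (heatDuhamel 0 g s) x‖ ≤
      (1 + (Module.finrank ℝ E : ℝ)) * A * (t - s) := by
  set d : ℝ := (Module.finrank ℝ E : ℝ) with hd
  have hd0 : 0 ≤ d := by positivity
  rcases hst.lt_or_eq with hlt | rfl
  swap
  · simp only [sub_self, norm_zero, mul_zero, le_refl]
  have ht : 0 < t := hs.trans_lt hlt
  have hregt : ∀ τ ∈ Ioo 0 t, IsCkBounded (n + 2) A (g τ) := fun τ hτ => hreg τ ⟨hτ.1, hτ.2.trans_le htT⟩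
  -- the representation of `Dⁿ heatDuhamel 0 g t x` as a time integral, and the pointwise bound
  obtain ⟨hIt, hbt⟩ := iteratedFDeriv_heatDuhamel_eq_setIntegral hg hregt hA (j := n) (by omega) x
  set Nt : ℝ → E [×n]→L[ℝ] F := fun τ => iteratedFDeriv ℝ n (heatDuhamelIntegrand g 0 t τ) x with hNt
  have hcontt : ∀ τ ∈ Ioo 0 t, Continuous (g τ) := fun τ hτ => (hregt τ hτ).contDiff.continuous
  have hbddt : ∀ τ ∈ Ioo 0 t, ∀ y, ‖g τ y‖ ≤ A := fun τ hτ y => (hregt τ hτ).norm_apply_le y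
  have hNtm : ∀ μ : Measure ℝ, AEStronglyMeasurable Nt μ := fun μ =>
    aestronglyMeasurable_iteratedFDeriv_heatDuhamelIntegrand hg hcontt hbddt n x μ
  have hNti : IntegrableOn Nt (Ioo 0 t) volume :=
    Integrable.mono' (integrableOn_const (C := A) measure_Ioo_lt_top.ne) (hNtm _)
      (Eventually.of_forall fun τ => hbt τ)
  rcases hs.lt_or_eq with hs0 | rfl
  swap
  · -- `s = 0`: `heatDuhamel 0 g 0 = 0`
    have h0 : iteratedFDeriv ℝ n (heatDuhamel 0 g 0) x = 0 := by
      have h00 : heatDuhamel 0 g 0 = (0 : E → F) := funext fun y => heatDuhamel_self 0 g y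
      rw [h00, iteratedFDeriv_zero, Pi.zero_apply]
    rw [h0, sub_zero, hIt, sub_zero]
    calc ‖∫ τ in Ioo 0 t, Nt τ‖ ≤ ∫ τ in Ioo 0 t, A :=
          norm_integral_le_of_norm_le (integrableOn_const (C := A) measure_Ioo_lt_top.ne)
            (Eventually.of_forall fun τ => hbt τ)
      _ = A * t := by rw [setIntegral_const, smul_eq_mul, Real.volume_real_Ioo_of_le ht.le, sub_zero, mul_comm]
      _ ≤ (1 + d) * A * t := by nlinarith [mul_nonneg hd0 (mul_nonneg hA ht.le)]
  -- `0 < s < t`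
  have hregs : ∀ τ ∈ Ioo 0 s, IsCkBounded (n + 2) A (g τ) := fun τ hτ =>
    hreg τ ⟨hτ.1, hτ.2.trans (hlt.trans_le htT)⟩
  obtain ⟨hIs, hbs⟩ := iteratedFDeriv_heatDuhamel_eq_setIntegral hg hregs hA (j := n) (by omega) x
  set Ns : ℝ → E [×n]→L[ℝ] F := fun τ => iteratedFDeriv ℝ n (heatDuhamelIntegrand g 0 s τ) x with hNs
  have hconts : ∀ τ ∈ Ioo 0 s, Continuous (g τ) := fun τ hτ => (hregs τ hτ).contDiff.continuous
  have hbdds : ∀ τ ∈ Ioo 0 s, ∀ y, ‖g τ y‖ ≤ A := fun τ hτ y => (hregs τ hτ).norm_apply_le y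
  have hNsm : ∀ μ : Measure ℝ, AEStronglyMeasurable Ns μ := fun μ =>
    aestronglyMeasurable_iteratedFDeriv_heatDuhamelIntegrand hg hconts hbdds n x μ
  have hNsi : IntegrableOn Ns (Ioo 0 s) volume :=
    Integrable.mono' (integrableOn_const (C := A) measure_Ioo_lt_top.ne) (hNsm _)
      (Eventually.of_forall fun τ => hbs τ)
  rw [hIt, hIs, setIntegral_Ioo_eq_add hs hst hNti]
  have e : (∫ τ in Ioo 0 s, Nt τ) + (∫ τ in Ioo s t, Nt τ) - ∫ τ in Ioo 0 s, Ns τ =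
      (∫ τ in Ioo 0 s, (Nt τ - Ns τ)) + ∫ τ in Ioo s t, Nt τ := by
    rw [integral_sub (hNti.mono_set (Ioo_subset_Ioo_right hst)) hNsi]; abel
  rw [e]
  -- the difference on `(0, s)`: `dA(t − s)` pointwise
  have hdiff : ∀ τ ∈ Ioo 0 s, ‖Nt τ - Ns τ‖ ≤ d * A * (t - s) := by
    intro τ hτ
    have hτt : τ ∈ Ioo 0 t := ⟨hτ.1, hτ.2.trans hlt⟩
    simp only [hNt, hNs, heatDuhamelIntegrand_of_mem hτ, heatDuhamelIntegrand_of_mem hτt]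
    have h := norm_iteratedFDeriv_heatExtension_sub_heatExtension_le (hregs τ hτ)
      (sub_pos.2 hτ.2) (by linarith : s - τ ≤ t - τ) x
    rwa [show t - τ - (s - τ) = t - s by ring] at h
  have b1 : ‖∫ τ in Ioo 0 s, (Nt τ - Ns τ)‖ ≤ d * A * (t - s) := by
    calc ‖∫ τ in Ioo 0 s, (Nt τ - Ns τ)‖ ≤ ∫ τ in Ioo 0 s, d * A * (t - s) :=
          norm_integral_le_of_norm_le (integrableOn_const (C := d * A * (t - s)) measure_Ioo_lt_top.ne)
            ((ae_restrict_iff' measurableSet_Ioo).2 (Eventually.of_forall hdiff))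
      _ = d * A * (t - s) * s := by
          rw [setIntegral_const, smul_eq_mul, Real.volume_real_Ioo_of_le hs, sub_zero, mul_comm]
      _ ≤ d * A * (t - s) := by
          have hs1 : s ≤ 1 := by linarith
          have : 0 ≤ d * A * (t - s) := by
            have := sub_nonneg.2 hst; positivity
          exact mul_le_of_le_one_right this hs1
  have b2 : ‖∫ τ in Ioo s t, Nt τ‖ ≤ A * (t - s) := by
    calc ‖∫ τ in Ioo s t, Nt τ‖ ≤ ∫ τ in Ioo s t, A :=
          norm_integral_le_of_norm_le (integrableOn_const (C := A) measure_Ioo_lt_top.ne)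
            (Eventually.of_forall fun τ => hbt τ)
      _ = A * (t - s) := by rw [setIntegral_const, smul_eq_mul, Real.volume_real_Ioo_of_le hst, mul_comm]
  calc ‖(∫ τ in Ioo 0 s, (Nt τ - Ns τ)) + ∫ τ in Ioo s t, Nt τ‖
      ≤ d * A * (t - s) + A * (t - s) := (norm_add_le _ _).trans (add_le_add b1 b2)
    _ = (1 + d) * A * (t - s) := by ring

/-- The heat-gradient Duhamel integrand of `C¹`-bounded data is the caloric extension of the
directional derivative: `∂ᵥ(e^{σΔ}k)(y) = e^{σΔ}(∂ᵥk)(y)`. [folklore] -/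
theorem fderiv_heatExtension_apply_eq {k : E → F} {m : ℕ} {B : ℝ} (hk : IsCkBounded (m + 1) B k)
    {σ : ℝ} (hσ : 0 < σ) (v : E) (y : E) :
    fderiv ℝ (heatExtension k σ) y v = heatExtension (fun z => fderiv ℝ k z v) σ y := by
  have hk1 : ContDiff ℝ 1 k := hk.contDiff.of_le (by exact_mod_cast Nat.le_add_left 1 m)
  rw [UnboundedOperators.fderiv_heatExtension_of_bounded hk1 hk.norm_apply_le hk.norm_fderiv_le hσ y]
  have hc : Continuous (fderiv ℝ k) := hk1.continuous_fderiv one_ne_zero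
  have := UnboundedOperators.heatExtension_clm_comp_of_bound (ContinuousLinearMap.apply ℝ F v)
    (g := fderiv ℝ k) hc hk.norm_fderiv_le hσ y
  simpa only [ContinuousLinearMap.apply_apply] using this.symm

/-- **The heat-gradient Duhamel integral of `Cⁿ⁺³` data has `Dⁿ` Lipschitz in time**: for
`g(τ) ∈ Cⁿ⁺³` bounded by `A` on `(0, T)`, `T ≤ 1`, `‖v‖ ≤ 1`, and `0 ≤ s ≤ t ≤ T`,
`‖Dⁿ(∫₀ᵗ∂ᵥe^{(t−τ)Δ}g)(x) − Dⁿ(∫₀ˢ∂ᵥe^{(s−τ)Δ}g)(x)‖ ≤ (1 + d) A (t − s)`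
(`∂ᵥe^{(r−τ)Δ}g(τ) = e^{(r−τ)Δ}(∂ᵥg(τ))`, a `Cⁿ⁺²` slice, and the previous argument). [cite: JiaSverak2014, §3 proof of Thm. 3.2 (arXiv p. 9), the term u₁] -/
theorem norm_iteratedFDeriv_heatGradDuhamel_sub_le (hg : StronglyMeasurable (uncurry g))
    (hreg : ∀ τ ∈ Ioo 0 T, IsCkBounded (n + 3) A (g τ)) (hA : 0 ≤ A) (hT1 : T ≤ 1) {v : E}
    (hv : ‖v‖ ≤ 1) {s t : ℝ} (hs : 0 ≤ s) (hst : s ≤ t) (htT : t ≤ T) (x : E) :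
    ‖iteratedFDeriv ℝ n (heatGradDuhamel 0 g v t) x - iteratedFDeriv ℝ n (heatGradDuhamel 0 g v s) x‖ ≤
      (1 + (Module.finrank ℝ E : ℝ)) * A * (t - s) := by
  set d : ℝ := (Module.finrank ℝ E : ℝ) with hd
  have hd0 : 0 ≤ d := by positivity
  have hvA : ‖v‖ * A ≤ A := by nlinarith [norm_nonneg v]
  rcases hst.lt_or_eq with hlt | rfl
  swap
  · simp only [sub_self, norm_zero, mul_zero, le_refl]
  have ht : 0 < t := hs.trans_lt hlt
  have hregt : ∀ τ ∈ Ioo 0 t, IsCkBounded (n + 2 + 1) A (g τ) := fun τ hτ => hreg τ ⟨hτ.1, hτ.2.trans_le htT⟩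
  obtain ⟨hIt, hbt⟩ := iteratedFDeriv_heatGradDuhamel_eq_setIntegral hg hregt hA v (j := n) (by omega) x
  set Nt : ℝ → E [×n]→L[ℝ] F := fun τ =>
    iteratedFDeriv ℝ n (fun y => fderiv ℝ (heatDuhamelIntegrand g 0 t τ) y v) x with hNt
  have hcontt : ∀ τ ∈ Ioo 0 t, Continuous (g τ) := fun τ hτ => (hregt τ hτ).contDiff.continuous
  have hbddt : ∀ τ ∈ Ioo 0 t, ∀ y, ‖g τ y‖ ≤ A := fun τ hτ y => (hregt τ hτ).norm_apply_le y
  -- measurability of the directional-derivative integrands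
  have hNm : ∀ (r : ℝ), (∀ τ ∈ Ioo 0 r, Continuous (g τ)) → (∀ τ ∈ Ioo 0 r, ∀ y, ‖g τ y‖ ≤ A) →
      ∀ μ : Measure ℝ, AEStronglyMeasurable (fun τ =>
        iteratedFDeriv ℝ n (fun y => fderiv ℝ (heatDuhamelIntegrand g 0 r τ) y v) x) μ := by
    intro r hc hb μ
    have hmeas := stronglyMeasurable_uncurry_heatDuhamelIntegrand (s := 0) (t := r) hg
    have hsmooth := contDiff_heatDuhamelIntegrand (s := 0) (t := r) hc hb
    have hmeas' : StronglyMeasurable (uncurry fun τ y => fderiv ℝ (heatDuhamelIntegrand g 0 r τ) y v) :=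
      stronglyMeasurable_fderiv_apply_param hmeas (fun τ y => ((hsmooth τ).differentiable (by simp)) y) v
    exact ((stronglyMeasurable_iteratedFDeriv_param hmeas'
      (contDiff_fderiv_apply_slice_of_contDiff hsmooth v) n).comp_measurable
      (measurable_id.prodMk measurable_const)).aestronglyMeasurable
  have hNti : IntegrableOn Nt (Ioo 0 t) volume :=
    Integrable.mono' (integrableOn_const (C := ‖v‖ * A) measure_Ioo_lt_top.ne) (hNm t hcontt hbddt _)
      (Eventually.of_forall fun τ => hbt τ)
  rcases hs.lt_or_eq with hs0 | rfl
  swap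
  · have h0 : iteratedFDeriv ℝ n (heatGradDuhamel 0 g v 0) x = 0 := by
      have h00 : heatGradDuhamel 0 g v 0 = (0 : E → F) := funext fun y => heatGradDuhamel_self 0 g v y
      rw [h00, iteratedFDeriv_zero, Pi.zero_apply]
    rw [h0, sub_zero, hIt, sub_zero]
    calc ‖∫ τ in Ioo 0 t, Nt τ‖ ≤ ∫ τ in Ioo 0 t, ‖v‖ * A :=
          norm_integral_le_of_norm_le (integrableOn_const (C := ‖v‖ * A) measure_Ioo_lt_top.ne)
            (Eventually.of_forall fun τ => hbt τ)
      _ = ‖v‖ * A * t := by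
          rw [setIntegral_const, smul_eq_mul, Real.volume_real_Ioo_of_le ht.le, sub_zero, mul_comm]
      _ ≤ (1 + d) * A * t := by
          have : ‖v‖ * A * t ≤ A * t := mul_le_mul_of_nonneg_right hvA ht.le
          nlinarith [mul_nonneg hd0 (mul_nonneg hA ht.le)]
  -- `0 < s < t`
  have hregs : ∀ τ ∈ Ioo 0 s, IsCkBounded (n + 2 + 1) A (g τ) := fun τ hτ =>
    hreg τ ⟨hτ.1, hτ.2.trans (hlt.trans_le htT)⟩
  obtain ⟨hIs, hbs⟩ := iteratedFDeriv_heatGradDuhamel_eq_setIntegral hg hregs hA v (j := n) (by omega) x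
  set Ns : ℝ → E [×n]→L[ℝ] F := fun τ =>
    iteratedFDeriv ℝ n (fun y => fderiv ℝ (heatDuhamelIntegrand g 0 s τ) y v) x with hNs
  have hconts : ∀ τ ∈ Ioo 0 s, Continuous (g τ) := fun τ hτ => (hregs τ hτ).contDiff.continuous
  have hbdds : ∀ τ ∈ Ioo 0 s, ∀ y, ‖g τ y‖ ≤ A := fun τ hτ y => (hregs τ hτ).norm_apply_le y
  have hNsi : IntegrableOn Ns (Ioo 0 s) volume :=
    Integrable.mono' (integrableOn_const (C := ‖v‖ * A) measure_Ioo_lt_top.ne) (hNm s hconts hbdds _)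
      (Eventually.of_forall fun τ => hbs τ)
  rw [hIt, hIs, setIntegral_Ioo_eq_add hs hst hNti]
  have e : (∫ τ in Ioo 0 s, Nt τ) + (∫ τ in Ioo s t, Nt τ) - ∫ τ in Ioo 0 s, Ns τ =
      (∫ τ in Ioo 0 s, (Nt τ - Ns τ)) + ∫ τ in Ioo s t, Nt τ := by
    rw [integral_sub (hNti.mono_set (Ioo_subset_Ioo_right hst)) hNsi]; abel
  rw [e]
  -- the difference on `(0, s)`
  have hdiff : ∀ τ ∈ Ioo 0 s, ‖Nt τ - Ns τ‖ ≤ d * A * (t - s) := by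
    intro τ hτ
    have hτt : τ ∈ Ioo 0 t := ⟨hτ.1, hτ.2.trans hlt⟩
    have hgk : IsCkBounded (n + 2 + 1) A (g τ) := hregs τ hτ
    have hg' : IsCkBounded (n + 2) (A * ‖v‖) fun z => fderiv ℝ (g τ) z v := hgk.fderiv_apply v
    have et : (fun y => fderiv ℝ (heatDuhamelIntegrand g 0 t τ) y v) =
        heatExtension (fun z => fderiv ℝ (g τ) z v) (t - τ) := by
      funext y
      rw [heatDuhamelIntegrand_of_mem hτt]
      exact fderiv_heatExtension_apply_eq hgk (sub_pos.2 hτt.2) v y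
    have es : (fun y => fderiv ℝ (heatDuhamelIntegrand g 0 s τ) y v) =
        heatExtension (fun z => fderiv ℝ (g τ) z v) (s - τ) := by
      funext y
      rw [heatDuhamelIntegrand_of_mem hτ]
      exact fderiv_heatExtension_apply_eq hgk (sub_pos.2 hτ.2) v y
    simp only [hNt, hNs, et, es]
    have h := norm_iteratedFDeriv_heatExtension_sub_heatExtension_le hg' (sub_pos.2 hτ.2)
      (by linarith : s - τ ≤ t - τ) x
    rw [show t - τ - (s - τ) = t - s by ring] at h
    refine h.trans ?_
    have hts : 0 ≤ t - s := sub_nonneg.2 hst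
    have : d * (A * ‖v‖) ≤ d * A := mul_le_mul_of_nonneg_left (by nlinarith [norm_nonneg v]) hd0
    nlinarith
  have b1 : ‖∫ τ in Ioo 0 s, (Nt τ - Ns τ)‖ ≤ d * A * (t - s) := by
    calc ‖∫ τ in Ioo 0 s, (Nt τ - Ns τ)‖ ≤ ∫ τ in Ioo 0 s, d * A * (t - s) :=
          norm_integral_le_of_norm_le (integrableOn_const (C := d * A * (t - s)) measure_Ioo_lt_top.ne)
            ((ae_restrict_iff' measurableSet_Ioo).2 (Eventually.of_forall hdiff))
      _ = d * A * (t - s) * s := by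
          rw [setIntegral_const, smul_eq_mul, Real.volume_real_Ioo_of_le hs, sub_zero, mul_comm]
      _ ≤ d * A * (t - s) := by
          have hs1 : s ≤ 1 := by linarith
          have : 0 ≤ d * A * (t - s) := by
            have := sub_nonneg.2 hst; positivity
          exact mul_le_of_le_one_right this hs1
  have b2 : ‖∫ τ in Ioo s t, Nt τ‖ ≤ A * (t - s) := by
    calc ‖∫ τ in Ioo s t, Nt τ‖ ≤ ∫ τ in Ioo s t, ‖v‖ * A :=
          norm_integral_le_of_norm_le (integrableOn_const (C := ‖v‖ * A) measure_Ioo_lt_top.ne)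
            (Eventually.of_forall fun τ => hbt τ)
      _ = ‖v‖ * A * (t - s) := by rw [setIntegral_const, smul_eq_mul, Real.volume_real_Ioo_of_le hst, mul_comm]
      _ ≤ A * (t - s) := mul_le_mul_of_nonneg_right hvA (sub_nonneg.2 hst)
  calc ‖(∫ τ in Ioo 0 s, (Nt τ - Ns τ)) + ∫ τ in Ioo s t, Nt τ‖
      ≤ d * A * (t - s) + A * (t - s) := (norm_add_le _ _).trans (add_le_add b1 b2)
    _ = (1 + d) * A * (t - s) := by ring

end DuhamelTime

/-! ### Time continuity of the Duhamel integrals of `C^{0,1/2}` data -/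

section HolderTime

variable {g : ℝ → E → F} {T A : ℝ}

/-- **Time increments of the caloric extension of `C^{0,α}` data** (general dimension):
`‖e^{tΔ}h(x) − e^{sΔ}h(x)‖ ≤ (1 + 2·2^{d/2}) A (t − s)^{α/2}` for `0 < s ≤ t`, `0 ≤ α ≤ 1`
(semigroup law and the mollification error for the Hölderian slice `e^{sΔ}h`; the tree's
`norm_heatExtension_sub_heatExtension_time_le_of_holder` is the case `E = ℝ³`). [folklore] -/
theorem norm_heatExtension_sub_heatExtension_le_of_isHolderField {h : E → F} {α : ℝ}
    (hh : IsHolderField 0 α A h) (hα0 : 0 ≤ α) (hα1 : α ≤ 1) {s t : ℝ} (hs : 0 < s) (hst : s ≤ t) (x : E) :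
    ‖heatExtension h t x - heatExtension h s x‖ ≤
      (1 + 2 * (2 : ℝ) ^ ((Module.finrank ℝ E : ℝ) / 2)) * A * (t - s) ^ (α / 2) := by
  have hA := hh.nonneg
  rcases hst.lt_or_eq with hlt | rfl
  · have hts : 0 < t - s := sub_pos.2 hlt
    have hsemi : heatExtension h t = heatExtension (heatExtension h s) (t - s) := by
      rw [UnboundedOperators.heatExtension_add_holds hh.memLp_top le_top hs hts]
      congr 1; ring
    rw [hsemi]
    have hhs : Continuous (heatExtension h s) :=
      (UnboundedOperators.contDiff_heatExtension_of_bound hh.continuous hh.norm_apply_le hs (m := 0)).continuous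
    have hCs : ∀ z, ‖heatExtension h s z‖ ≤ A := fun z =>
      UnboundedOperators.norm_heatExtension_le_of_bound hh.norm_apply_le hs z
    have hHs : ∀ y z, ‖heatExtension h s y - heatExtension h s z‖ ≤ A * ‖y - z‖ ^ α := fun y z =>
      norm_heatExtension_sub_heatExtension_le_of_holder hh.continuous hh.norm_apply_le hh.norm_sub_le hs y z
    exact UnboundedOperators.norm_heatExtension_sub_self_le_of_holder hhs hCs hA hα0 hα1 hHs hts x
  · simp only [sub_self, norm_zero]
    positivity

omit [CompleteSpace F] in
/-- **Time increments of the Duhamel integral of `C^{0,1/2}` data**: for jointly strongly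
measurable `g` with `g(τ) ∈ C^{0,1/2}` (constant `A`) for `τ ∈ (0, T)`, `T ≤ 1`, and
`0 ≤ s ≤ t ≤ T`,
`‖∫₀ᵗe^{(t−τ)Δ}g(τ)(x)dτ − ∫₀ˢe^{(s−τ)Δ}g(τ)(x)dτ‖ ≤ A(t − s) + (1 + 2·2^{d/2}) A (t − s)^{1/4}`. [cite: JiaSverak2014, §2 Lemma 2.1 (parabolic Hölder continuity of the potentials)] -/
theorem norm_heatDuhamel_sub_le_of_holder [CompleteSpace F] (hg : StronglyMeasurable (uncurry g))
    (hreg : ∀ τ ∈ Ioo 0 T, IsHolderField 0 (1 / 2) A (g τ)) (hA : 0 ≤ A) (hT1 : T ≤ 1) {s t : ℝ}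
    (hs : 0 ≤ s) (hst : s ≤ t) (htT : t ≤ T) (x : E) :
    ‖heatDuhamel 0 g t x - heatDuhamel 0 g s x‖ ≤
      A * (t - s) + (1 + 2 * (2 : ℝ) ^ ((Module.finrank ℝ E : ℝ) / 2)) * A * (t - s) ^ (1 / 4 : ℝ) := by
  set c : ℝ := 1 + 2 * (2 : ℝ) ^ ((Module.finrank ℝ E : ℝ) / 2) with hc
  have hc0 : 0 ≤ c := by positivity
  rcases hst.lt_or_eq with hlt | rfl
  swap
  · simp only [sub_self, norm_zero, mul_zero, zero_add]
    rw [Real.zero_rpow (by norm_num)]; simp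
  have ht : 0 < t := hs.trans_lt hlt
  have hts0 : 0 ≤ t - s := sub_nonneg.2 hst
  -- the integrands and their bounds
  have hcontr : ∀ {r : ℝ}, r ≤ T → ∀ τ ∈ Ioo 0 r, Continuous (g τ) := fun hr τ hτ =>
    (hreg τ ⟨hτ.1, hτ.2.trans_le hr⟩).continuous
  have hbddr : ∀ {r : ℝ}, r ≤ T → ∀ τ ∈ Ioo 0 r, ∀ y, ‖g τ y‖ ≤ A := fun hr τ hτ y =>
    (hreg τ ⟨hτ.1, hτ.2.trans_le hr⟩).norm_apply_le y
  set Nt : ℝ → F := fun τ => heatDuhamelIntegrand g 0 t τ x with hNt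
  set Ns : ℝ → F := fun τ => heatDuhamelIntegrand g 0 s τ x with hNs
  have hbN : ∀ {r : ℝ}, r ≤ T → ∀ τ, ‖heatDuhamelIntegrand g 0 r τ x‖ ≤ A := by
    intro r hr τ
    have := norm_iteratedFDeriv_heatDuhamelIntegrand_le (g := g) (s := 0) (t := r) (i := 0)
      (B := fun _ => A) (fun _ => hA)
      (fun τ hτ y => by
        rw [norm_iteratedFDeriv_zero]
        exact UnboundedOperators.norm_heatExtension_le_of_bound (hbddr hr τ hτ) (sub_pos.2 hτ.2) y) τ x
    rwa [norm_iteratedFDeriv_zero] at this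
  have hmN : ∀ {r : ℝ}, r ≤ T → ∀ μ : Measure ℝ, AEStronglyMeasurable (fun τ => heatDuhamelIntegrand g 0 r τ x) μ := by
    intro r hr μ
    have h0 := aestronglyMeasurable_iteratedFDeriv_heatDuhamelIntegrand hg (hcontr hr) (hbddr hr) 0 x μ
    have e : (fun τ => heatDuhamelIntegrand g 0 r τ x) = fun τ =>
        (continuousMultilinearCurryFin0 ℝ E F) (iteratedFDeriv ℝ 0 (heatDuhamelIntegrand g 0 r τ) x) := by
      funext τ; simp
    rw [e]
    exact (continuousMultilinearCurryFin0 ℝ E F).continuous.comp_aestronglyMeasurable h0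
  have hNti : IntegrableOn Nt (Ioo 0 t) volume :=
    Integrable.mono' (integrableOn_const (C := A) measure_Ioo_lt_top.ne) (hmN htT _)
      (Eventually.of_forall fun τ => hbN htT τ)
  have hIt : heatDuhamel 0 g t x = ∫ τ in Ioo 0 t, Nt τ := heatDuhamel_eq_integral_heatDuhamelIntegrand 0 g t x
  rcases hs.lt_or_eq with hs0 | rfl
  swap
  · rw [heatDuhamel_self, sub_zero, hIt, sub_zero]
    calc ‖∫ τ in Ioo 0 t, Nt τ‖ ≤ ∫ τ in Ioo 0 t, A :=
          norm_integral_le_of_norm_le (integrableOn_const (C := A) measure_Ioo_lt_top.ne)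
            (Eventually.of_forall fun τ => hbN htT τ)
      _ = A * t := by rw [setIntegral_const, smul_eq_mul, Real.volume_real_Ioo_of_le ht.le, sub_zero, mul_comm]
      _ ≤ A * t + c * A * t ^ (1 / 4 : ℝ) := le_add_of_nonneg_right (by positivity)
  have hsT : s ≤ T := hlt.le.trans htT
  have hNsi : IntegrableOn Ns (Ioo 0 s) volume :=
    Integrable.mono' (integrableOn_const (C := A) measure_Ioo_lt_top.ne) (hmN hsT _)
      (Eventually.of_forall fun τ => hbN hsT τ)
  have hIs : heatDuhamel 0 g s x = ∫ τ in Ioo 0 s, Ns τ := heatDuhamel_eq_integral_heatDuhamelIntegrand 0 g s x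
  rw [hIt, hIs, setIntegral_Ioo_eq_add hs hst hNti]
  have e : (∫ τ in Ioo 0 s, Nt τ) + (∫ τ in Ioo s t, Nt τ) - ∫ τ in Ioo 0 s, Ns τ =
      (∫ τ in Ioo 0 s, (Nt τ - Ns τ)) + ∫ τ in Ioo s t, Nt τ := by
    rw [integral_sub (hNti.mono_set (Ioo_subset_Ioo_right hst)) hNsi]; abel
  rw [e]
  have hdiff : ∀ τ ∈ Ioo 0 s, ‖Nt τ - Ns τ‖ ≤ c * A * (t - s) ^ (1 / 4 : ℝ) := by
    intro τ hτ
    have hτt : τ ∈ Ioo 0 t := ⟨hτ.1, hτ.2.trans hlt⟩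
    have hτT : τ ∈ Ioo 0 T := ⟨hτ.1, hτ.2.trans_le hsT⟩
    simp only [hNt, hNs, heatDuhamelIntegrand_of_mem hτ, heatDuhamelIntegrand_of_mem hτt]
    have h := norm_heatExtension_sub_heatExtension_le_of_isHolderField (hreg τ hτT) (by norm_num)
      (by norm_num) (sub_pos.2 hτ.2) (by linarith : s - τ ≤ t - τ) x
    rw [show t - τ - (s - τ) = t - s by ring, show ((1 : ℝ) / 2) / 2 = 1 / 4 by norm_num] at h
    exact h
  have b1 : ‖∫ τ in Ioo 0 s, (Nt τ - Ns τ)‖ ≤ c * A * (t - s) ^ (1 / 4 : ℝ) := by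
    calc ‖∫ τ in Ioo 0 s, (Nt τ - Ns τ)‖ ≤ ∫ τ in Ioo 0 s, c * A * (t - s) ^ (1 / 4 : ℝ) :=
          norm_integral_le_of_norm_le (integrableOn_const (C := c * A * (t - s) ^ (1 / 4 : ℝ))
            measure_Ioo_lt_top.ne) ((ae_restrict_iff' measurableSet_Ioo).2 (Eventually.of_forall hdiff))
      _ = c * A * (t - s) ^ (1 / 4 : ℝ) * s := by
          rw [setIntegral_const, smul_eq_mul, Real.volume_real_Ioo_of_le hs, sub_zero, mul_comm]
      _ ≤ c * A * (t - s) ^ (1 / 4 : ℝ) := by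
          have hs1 : s ≤ 1 := by linarith
          exact mul_le_of_le_one_right (by positivity) hs1
  have b2 : ‖∫ τ in Ioo s t, Nt τ‖ ≤ A * (t - s) := by
    calc ‖∫ τ in Ioo s t, Nt τ‖ ≤ ∫ τ in Ioo s t, A :=
          norm_integral_le_of_norm_le (integrableOn_const (C := A) measure_Ioo_lt_top.ne)
            (Eventually.of_forall fun τ => hbN htT τ)
      _ = A * (t - s) := by rw [setIntegral_const, smul_eq_mul, Real.volume_real_Ioo_of_le hst, mul_comm]
  calc ‖(∫ τ in Ioo 0 s, (Nt τ - Ns τ)) + ∫ τ in Ioo s t, Nt τ‖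
      ≤ c * A * (t - s) ^ (1 / 4 : ℝ) + A * (t - s) := (norm_add_le _ _).trans (add_le_add b1 b2)
    _ = A * (t - s) + c * A * (t - s) ^ (1 / 4 : ℝ) := by ring

omit [InnerProductSpace ℝ E] [FiniteDimensional ℝ E] [MeasurableSpace E] [BorelSpace E] [CompleteSpace F] in
/-- A `C^{0,1}` bound (Lipschitz) from a derivative bound, in the form consumed by the
mollification estimate: `‖k y − k z‖ ≤ L ‖y − z‖^1`. [folklore] -/
theorem norm_sub_le_mul_rpow_one_of_fderiv_le [NormedSpace ℝ E] {G : Type*} [NormedAddCommGroup G] [NormedSpace ℝ G]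
    {k : E → G} (hk : Differentiable ℝ k) {L : ℝ} (hL : ∀ z, ‖fderiv ℝ k z‖ ≤ L) (y z : E) :
    ‖k y - k z‖ ≤ L * ‖y - z‖ ^ (1 : ℝ) := by
  rw [Real.rpow_one]
  exact Convex.norm_image_sub_le_of_norm_fderiv_le (s := univ) (fun w _ => hk w) (fun w _ => hL w)
    convex_univ (mem_univ z) (mem_univ y)

omit [CompleteSpace F] in
/-- **Time increments of the heat-gradient Duhamel integral of `C^{0,1/2}` data**: for jointly
strongly measurable `g` with `g(τ) ∈ C^{0,1/2}` (constant `A`) on `(0, T)`, `T ≤ 1`, `‖v‖ ≤ 1`, and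
`0 ≤ s ≤ t ≤ T`,
`‖∫₀ᵗ∂ᵥe^{(t−τ)Δ}g(τ)(x)dτ − ∫₀ˢ∂ᵥe^{(s−τ)Δ}g(τ)(x)dτ‖ ≤ G A ((4/3)(t − s)^{3/4} + 4c (t − s)^{1/2})`
with `G` the constant of `exists_holder_gain_heatExtension 0` and `c = 1 + 2·2^{d/2}` (on `(s, t)`
the integrand is `≤ G(t−τ)^{-1/4}A`; on `(0, s)` it is `e^{(t−s)Δ}k − k` for the slice
`k = ∂ᵥe^{(s−τ)Δ}g(τ)`, bounded by `G(s−τ)^{-1/4}A` and Lipschitz with constant `G(s−τ)^{-3/4}A`,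
so that the mollification error is `≤ cG(s−τ)^{-3/4}A(t−s)^{1/2}`). [cite: JiaSverak2014, §2 Lemma 2.1 (parabolic Hölder continuity of the potentials)] -/
theorem exists_norm_heatGradDuhamel_sub_le_of_holder [CompleteSpace F] :
    ∃ C : ℝ, 0 ≤ C ∧ ∀ {g : ℝ → E → F} {T A : ℝ} {v : E}, StronglyMeasurable (uncurry g) →
      (∀ τ ∈ Ioo 0 T, IsHolderField 0 (1 / 2) A (g τ)) → T ≤ 1 → ‖v‖ ≤ 1 →
      ∀ {s t : ℝ}, 0 ≤ s → s ≤ t → t ≤ T → ∀ x : E,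
        ‖heatGradDuhamel 0 g v t x - heatGradDuhamel 0 g v s x‖ ≤
          C * A * ((t - s) ^ (3 / 4 : ℝ) + (t - s) ^ (1 / 2 : ℝ)) := by
  obtain ⟨G, hG0, hGain⟩ := exists_holder_gain_heatExtension (E := E) (F := F) 0
  set c : ℝ := 1 + 2 * (2 : ℝ) ^ ((Module.finrank ℝ E : ℝ) / 2) with hc
  have hc0 : 0 ≤ c := by positivity
  refine ⟨4 * c * G + 2 * G, by positivity, ?_⟩
  intro g T A v hg hreg hT1 hv s t hs hst htT x
  rcases hst.lt_or_eq with hlt | rfl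
  swap
  · simp only [sub_self, norm_zero]
    rw [Real.zero_rpow (by norm_num), Real.zero_rpow (by norm_num)]; simp
  have ht : 0 < t := hs.trans_lt hlt
  have hA : 0 ≤ A := (hreg (t / 2) ⟨by positivity, by linarith⟩).nonneg
  have hts0 : 0 < t - s := sub_pos.2 hlt
  -- clean gain bounds at `α = 1/2`
  have hG1 : ∀ {a : E → F}, IsHolderField 0 (1 / 2) A a → ∀ {σ : ℝ}, 0 < σ → ∀ y,
      ‖iteratedFDeriv ℝ 1 (heatExtension a σ) y‖ ≤ G * σ ^ (-(1 / 4 : ℝ)) * A := fun ha σ hσ y => by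
    have := (hGain hσ (by norm_num) (by norm_num) ha y).1
    convert this using 3; norm_num
  have hG2 : ∀ {a : E → F}, IsHolderField 0 (1 / 2) A a → ∀ {σ : ℝ}, 0 < σ → ∀ y,
      ‖iteratedFDeriv ℝ 2 (heatExtension a σ) y‖ ≤ G * σ ^ (-(3 / 4 : ℝ)) * A := fun ha σ hσ y => by
    have := (hGain hσ (by norm_num) (by norm_num) ha y).2.1
    convert this using 3; norm_num
  -- the integrands `τ ↦ ∂ᵥ(e^{(r−τ)Δ}g(τ))(x)` on `(0, r)`, `r ≤ T`
  have hcontr : ∀ {r : ℝ}, r ≤ T → ∀ τ ∈ Ioo 0 r, Continuous (g τ) := fun hr τ hτ =>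
    (hreg τ ⟨hτ.1, hτ.2.trans_le hr⟩).continuous
  have hbddr : ∀ {r : ℝ}, r ≤ T → ∀ τ ∈ Ioo 0 r, ∀ y, ‖g τ y‖ ≤ A := fun hr τ hτ y =>
    (hreg τ ⟨hτ.1, hτ.2.trans_le hr⟩).norm_apply_le y
  have hNbound : ∀ {r : ℝ}, r ≤ T → ∀ τ ∈ Ioo 0 r,
      ‖fderiv ℝ (heatDuhamelIntegrand g 0 r τ) x v‖ ≤ G * A * ‖(r - τ) ^ (-(1 / 4 : ℝ))‖ := by
    intro r hr τ hτ
    rw [heatDuhamelIntegrand_of_mem hτ]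
    have hσ : 0 < r - τ := sub_pos.2 hτ.2
    have hreg' := hreg τ ⟨hτ.1, hτ.2.trans_le hr⟩
    calc ‖fderiv ℝ (heatExtension (g τ) (r - τ)) x v‖
        ≤ ‖fderiv ℝ (heatExtension (g τ) (r - τ)) x‖ * ‖v‖ := ContinuousLinearMap.le_opNorm _ _
      _ ≤ (G * (r - τ) ^ (-(1 / 4 : ℝ)) * A) * 1 := by
          refine mul_le_mul ?_ hv (norm_nonneg _) (by positivity)
          rw [← norm_iteratedFDeriv_one (𝕜 := ℝ)]
          exact hG1 hreg' hσ x
      _ ≤ G * A * ‖(r - τ) ^ (-(1 / 4 : ℝ))‖ := by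
          rw [mul_one, Real.norm_eq_abs, abs_of_pos (Real.rpow_pos_of_pos hσ _)]; ring_nf; exact le_rfl
  have hNmeas : ∀ {r : ℝ}, r ≤ T → ∀ μ : Measure ℝ,
      AEStronglyMeasurable (fun τ => fderiv ℝ (heatDuhamelIntegrand g 0 r τ) x v) μ := by
    intro r hr μ
    have hmeas := stronglyMeasurable_uncurry_heatDuhamelIntegrand (s := 0) (t := r) hg
    have hsmooth := contDiff_heatDuhamelIntegrand (s := 0) (t := r) (hcontr hr) (hbddr hr)
    exact ((stronglyMeasurable_fderiv_apply_param hmeas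
      (fun τ y => ((hsmooth τ).differentiable (by simp)) y) v).comp_measurable
      (measurable_id.prodMk measurable_const)).aestronglyMeasurable
  obtain ⟨hIq, hIqval⟩ := integral_Ioo_norm_sub_rpow (s := 0) (t := t) (e := -(1 / 4 : ℝ)) ht (by norm_num)
  have hNti : IntegrableOn (fun τ => fderiv ℝ (heatDuhamelIntegrand g 0 t τ) x v) (Ioo 0 t) volume :=
    Integrable.mono' (hIq.const_mul (G * A)) (hNmeas htT _)
      ((ae_restrict_iff' measurableSet_Ioo).2 (Eventually.of_forall fun τ hτ => hNbound htT τ hτ))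
  have hIt : heatGradDuhamel 0 g v t x = ∫ τ in Ioo 0 t, fderiv ℝ (heatDuhamelIntegrand g 0 t τ) x v :=
    heatGradDuhamel_eq_integral_fderiv_heatDuhamelIntegrand 0 g v t x
  -- the piece on `(s, t)`
  obtain ⟨hIst, hIstval⟩ := integral_Ioo_norm_sub_rpow (s := s) (t := t) (e := -(1 / 4 : ℝ)) hlt (by norm_num)
  have b2 : ‖∫ τ in Ioo s t, fderiv ℝ (heatDuhamelIntegrand g 0 t τ) x v‖ ≤ 2 * G * A * (t - s) ^ (3 / 4 : ℝ) := by
    calc ‖∫ τ in Ioo s t, fderiv ℝ (heatDuhamelIntegrand g 0 t τ) x v‖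
        ≤ ∫ τ in Ioo s t, G * A * ‖(t - τ) ^ (-(1 / 4 : ℝ))‖ :=
          norm_integral_le_of_norm_le (hIst.const_mul (G * A))
            ((ae_restrict_iff' measurableSet_Ioo).2 (Eventually.of_forall fun τ hτ =>
              hNbound htT τ ⟨hs.trans_lt hτ.1, hτ.2⟩))
      _ = G * A * ((t - s) ^ (3 / 4 : ℝ) / (3 / 4)) := by
          rw [integral_const_mul, hIstval]; norm_num
      _ ≤ 2 * G * A * (t - s) ^ (3 / 4 : ℝ) := by
          have : 0 ≤ G * A * (t - s) ^ (3 / 4 : ℝ) := by positivity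
          nlinarith
  rcases hs.lt_or_eq with hs0 | rfl
  swap
  · rw [heatGradDuhamel_self, sub_zero, hIt, sub_zero]
    refine b2.trans ?_
    simp only [sub_zero]
    have h1 : 0 ≤ (4 * c * G + 2 * G) * A * t ^ (1 / 2 : ℝ) := by positivity
    have h2 : 2 * G * A * t ^ (3 / 4 : ℝ) ≤ (4 * c * G + 2 * G) * A * t ^ (3 / 4 : ℝ) := by
      have : 2 * G * A ≤ (4 * c * G + 2 * G) * A := by nlinarith [mul_nonneg (mul_nonneg hc0 hG0) hA]
      exact mul_le_mul_of_nonneg_right this (by positivity)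
    rw [mul_add]
    linarith
  -- `0 < s < t`: the piece on `(0, s)`
  have hsT : s ≤ T := hlt.le.trans htT
  obtain ⟨hIqs, -⟩ := integral_Ioo_norm_sub_rpow (s := 0) (t := s) (e := -(1 / 4 : ℝ)) hs0 (by norm_num)
  have hNsi : IntegrableOn (fun τ => fderiv ℝ (heatDuhamelIntegrand g 0 s τ) x v) (Ioo 0 s) volume :=
    Integrable.mono' (hIqs.const_mul (G * A)) (hNmeas hsT _)
      ((ae_restrict_iff' measurableSet_Ioo).2 (Eventually.of_forall fun τ hτ => hNbound hsT τ hτ))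
  have hIs : heatGradDuhamel 0 g v s x = ∫ τ in Ioo 0 s, fderiv ℝ (heatDuhamelIntegrand g 0 s τ) x v :=
    heatGradDuhamel_eq_integral_fderiv_heatDuhamelIntegrand 0 g v s x
  rw [hIt, hIs, setIntegral_Ioo_eq_add hs hst hNti]
  have e : (∫ τ in Ioo 0 s, fderiv ℝ (heatDuhamelIntegrand g 0 t τ) x v) +
        (∫ τ in Ioo s t, fderiv ℝ (heatDuhamelIntegrand g 0 t τ) x v) -
        ∫ τ in Ioo 0 s, fderiv ℝ (heatDuhamelIntegrand g 0 s τ) x v =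
      (∫ τ in Ioo 0 s, (fderiv ℝ (heatDuhamelIntegrand g 0 t τ) x v - fderiv ℝ (heatDuhamelIntegrand g 0 s τ) x v)) +
        ∫ τ in Ioo s t, fderiv ℝ (heatDuhamelIntegrand g 0 t τ) x v := by
    rw [integral_sub (hNti.mono_set (Ioo_subset_Ioo_right hst)) hNsi]; abel
  rw [e]
  obtain ⟨hJ, hJval⟩ := integral_Ioo_norm_sub_rpow (s := 0) (t := s) (e := -(3 / 4 : ℝ)) hs0 (by norm_num)
  have hdiff : ∀ τ ∈ Ioo 0 s, ‖fderiv ℝ (heatDuhamelIntegrand g 0 t τ) x v - fderiv ℝ (heatDuhamelIntegrand g 0 s τ) x v‖ ≤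
      c * G * A * (t - s) ^ (1 / 2 : ℝ) * ‖(s - τ) ^ (-(3 / 4 : ℝ))‖ := by
    intro τ hτ
    have hτt : τ ∈ Ioo 0 t := ⟨hτ.1, hτ.2.trans hlt⟩
    have hτT : τ ∈ Ioo 0 T := ⟨hτ.1, hτ.2.trans_le hsT⟩
    have hσ : 0 < s - τ := sub_pos.2 hτ.2
    have hreg' := hreg τ hτT
    rw [heatDuhamelIntegrand_of_mem hτt, heatDuhamelIntegrand_of_mem hτ]
    -- the slice `k = e^{(s−τ)Δ}g(τ)` is smooth, with `Dk`, `D²k` controlled by the gains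
    set k : E → F := heatExtension (g τ) (s - τ) with hk
    have hksm : ContDiff ℝ 2 k :=
      UnboundedOperators.contDiff_heatExtension_of_bound hreg'.continuous hreg'.norm_apply_le hσ
    have hk0 : ∀ z, ‖k z‖ ≤ A := fun z => UnboundedOperators.norm_heatExtension_le_of_bound hreg'.norm_apply_le hσ z
    have hk1 : ∀ z, ‖fderiv ℝ k z‖ ≤ G * (s - τ) ^ (-(1 / 4 : ℝ)) * A := fun z => by
      rw [← norm_iteratedFDeriv_one (𝕜 := ℝ)]; exact hG1 hreg' hσ z
    have hk2 : ∀ z, ‖fderiv ℝ (fderiv ℝ k) z‖ ≤ G * (s - τ) ^ (-(3 / 4 : ℝ)) * A := fun z => by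
      rw [UnboundedOperators.HeatHolder.norm_fderiv_fderiv_eq]; exact hG2 hreg' hσ z
    have hkB : IsCkBounded 1 (max A (G * (s - τ) ^ (-(1 / 4 : ℝ)) * A)) k := by
      refine ⟨hksm.of_le one_le_two, fun j hj z => ?_⟩
      rcases Nat.le_one_iff_eq_zero_or_eq_one.1 hj with rfl | rfl
      · rw [norm_iteratedFDeriv_zero]; exact (hk0 z).trans (le_max_left _ _)
      · rw [norm_iteratedFDeriv_one]
        exact (hk1 z).trans (le_max_right _ _)
    -- semigroup: `e^{(t−τ)Δ}g(τ) = e^{(t−s)Δ}k`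
    have hsemi : heatExtension (g τ) (t - τ) = heatExtension k (t - s) := by
      rw [hk, UnboundedOperators.heatExtension_add_holds hreg'.memLp_top le_top hσ hts0]
      congr 1; ring
    rw [hsemi, fderiv_heatExtension_apply_eq (m := 0) hkB hts0 v x]
    -- the directional slice `k' = ∂ᵥk`: bounded, Lipschitz
    set k' : E → F := fun z => fderiv ℝ k z v with hk'
    have hk'c : Continuous k' := (hksm.continuous_fderiv two_ne_zero).clm_apply continuous_const
    have hk'0 : ∀ z, ‖k' z‖ ≤ G * (s - τ) ^ (-(1 / 4 : ℝ)) * A := fun z =>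
      ((ContinuousLinearMap.le_opNorm _ _).trans (mul_le_mul (hk1 z) hv (norm_nonneg _) (by positivity))).trans
        (by rw [mul_one])
    have hk'd : Differentiable ℝ k' := fun z =>
      ((hksm.fderiv_right (m := 1) le_rfl).differentiable one_ne_zero z).clm_apply (differentiableAt_const v)
    have hk'1 : ∀ z, ‖fderiv ℝ k' z‖ ≤ G * (s - τ) ^ (-(3 / 4 : ℝ)) * A := fun z => by
      have e1 : fderiv ℝ k' z = (fderiv ℝ (fderiv ℝ k) z).flip v := by
        rw [hk']
        ext w
        rw [fderiv_clm_apply ((hksm.fderiv_right (m := 1) le_rfl).differentiable one_ne_zero z)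
          (differentiableAt_const v)]
        simp
      rw [e1]
      calc ‖(fderiv ℝ (fderiv ℝ k) z).flip v‖ ≤ ‖(fderiv ℝ (fderiv ℝ k) z).flip‖ * ‖v‖ :=
            ContinuousLinearMap.le_opNorm _ _
        _ ≤ G * (s - τ) ^ (-(3 / 4 : ℝ)) * A * 1 := by
            rw [ContinuousLinearMap.opNorm_flip]
            exact mul_le_mul (hk2 z) hv (norm_nonneg _) (by positivity)
        _ = G * (s - τ) ^ (-(3 / 4 : ℝ)) * A := mul_one _
    have hk'H : ∀ y z, ‖k' y - k' z‖ ≤ (G * (s - τ) ^ (-(3 / 4 : ℝ)) * A) * ‖y - z‖ ^ (1 : ℝ) :=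
      norm_sub_le_mul_rpow_one_of_fderiv_le hk'd hk'1
    have hmol := UnboundedOperators.norm_heatExtension_sub_self_le_of_holder hk'c hk'0 (by positivity)
      zero_le_one le_rfl hk'H hts0 x
    refine hmol.trans (le_of_eq ?_)
    rw [Real.norm_eq_abs, abs_of_pos (Real.rpow_pos_of_pos hσ _), show ((1 : ℝ) / 2) = 1 / 2 from rfl]
    ring
  have b1 : ‖∫ τ in Ioo 0 s, (fderiv ℝ (heatDuhamelIntegrand g 0 t τ) x v - fderiv ℝ (heatDuhamelIntegrand g 0 s τ) x v)‖ ≤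
      4 * c * G * A * (t - s) ^ (1 / 2 : ℝ) := by
    calc ‖∫ τ in Ioo 0 s, (fderiv ℝ (heatDuhamelIntegrand g 0 t τ) x v - fderiv ℝ (heatDuhamelIntegrand g 0 s τ) x v)‖
        ≤ ∫ τ in Ioo 0 s, c * G * A * (t - s) ^ (1 / 2 : ℝ) * ‖(s - τ) ^ (-(3 / 4 : ℝ))‖ :=
          norm_integral_le_of_norm_le (hJ.const_mul _)
            ((ae_restrict_iff' measurableSet_Ioo).2 (Eventually.of_forall hdiff))
      _ = c * G * A * (t - s) ^ (1 / 2 : ℝ) * (s ^ (1 / 4 : ℝ) / (1 / 4)) := by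
          rw [integral_const_mul, hJval, sub_zero]; norm_num
      _ ≤ 4 * c * G * A * (t - s) ^ (1 / 2 : ℝ) := by
          have hs1 : s ^ (1 / 4 : ℝ) ≤ 1 := Real.rpow_le_one hs (by linarith) (by norm_num)
          have : 0 ≤ c * G * A * (t - s) ^ (1 / 2 : ℝ) := by positivity
          nlinarith
  calc ‖(∫ τ in Ioo 0 s, (fderiv ℝ (heatDuhamelIntegrand g 0 t τ) x v - fderiv ℝ (heatDuhamelIntegrand g 0 s τ) x v)) +
        ∫ τ in Ioo s t, fderiv ℝ (heatDuhamelIntegrand g 0 t τ) x v‖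
      ≤ 4 * c * G * A * (t - s) ^ (1 / 2 : ℝ) + 2 * G * A * (t - s) ^ (3 / 4 : ℝ) :=
        (norm_add_le _ _).trans (add_le_add b1 b2)
    _ ≤ (4 * c * G + 2 * G) * A * ((t - s) ^ (3 / 4 : ℝ) + (t - s) ^ (1 / 2 : ℝ)) := by
        have h34 : 0 ≤ (t - s) ^ (3 / 4 : ℝ) := by positivity
        have h12 : 0 ≤ (t - s) ^ (1 / 2 : ℝ) := by positivity
        nlinarith [mul_nonneg (mul_nonneg (mul_nonneg hc0 hG0) hA) h34, mul_nonneg (mul_nonneg hG0 hA) h12]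

end HolderTime





end Literature.Analysis.FluidPDE

end
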